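import Summits.QuantumFields.BalabanUV.T4Continuum.Spine.NE1p.DressedSmallFieldLabelCounts

/-!
# T⁴ programme, spine estimate NE1′ (node O3b/H2) — ROAD P1's SOURCE-PENCIL TWINS AT EVERY RESUMMATION INDEX: the μ-part of the
# dressed small-field output for cores indexed by INNER LABELS, OUTER LABELS and ANCHORED COMPONENTS (PART 2 of 2)

Cell `pub-balaban`, sub-cell `t4`, BINDER-OWNERS row NE1′; owner lineage t4-ne1p-p1 (PROVER seat P1, «RG-trajectory comparison …
μ-uniformity through the printed small-field bounds»), generation 30; ADDITIVE — imports PART 1 `Spine/NE1p/DressedSmallFieldLabelCounts`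
ONLY (the table-free counts `count_innerLabels_geometry` ∕ `count_outerLabels_geometry` ∕ `count_components_geometry`; → N0w p234287 →
N0v → N0u → N0t → N0s p230233 → N0r → N0q → N0p); THEOREMS ONLY (0 def, 0 `def … : Prop`, 0 cite); nothing of N0s–N0w ∕ PART 1 ∕ row
NE5's ∕ the substrate's ∕ b13's modules is restated — their declarations are used BY NAME.

WHAT (kernel).  N0s §3's `muPart_locE_le_of_coresAt_pencil_count` — the μ-PART of the dressed small-field `locE`-output built from
(2.14)-cores along the SOURCE PENCIL `h₀ + s • v`, `‖s‖ < μ₁` (Schwarz on the source disc: `‖E[act sμ](X₀) − E[act 0](X₀)‖ ≤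
(e ν c₁ K₀²·A·e^{−r₁ d(X₀)})·μ₀∕(μ₁ − μ₀)` for `‖sμ‖ ≤ μ₀ < μ₁`) — fired ONCE per term index with its table-blind count `hCount`
SUPPLIED by PART 1:
* `muPart_locE_le_of_coresAt_pencil_innerLabels` — index `Σ _ : Finset CubeK, Finset Dk.Dom × Finset Bnd` (labels `⟨Z₀∖Y₀, 𝐃, P⟩`
  of `Z₀ = foot Z`, the SECOND resummation step), `hCount` := `count_innerLabels_geometry`; the twin of N0u's END;
* `muPart_locE_le_of_coresAt_pencil_outerLabels` — index `Σ _ : Finset Cube, Σ F : Finset D.Dom, ∀ Z ∈ F, κ Z` (labels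
  `⟨Z∖Z′₀, {Z′_i}, inner data⟩`, steps THREE and FOUR), `hCount` := `count_outerLabels_geometry`; the twin of N0v's END;
* `muPart_locE_le_of_coresAt_pencil_components` — the same with inner data = anchored scale-`k` components carrying inner labels,
  `hCount` := `count_components_geometry`; the twin of N0w's END.
In each, the observable's table contribution `v` scaled by the source enters ONLY the per-label AMPLITUDE clause `hAmp`, through the
radius `‖h₀‖ + μ₁‖v‖` in the read-out growth `e^{N₁(‖h₀‖ + μ₁‖v‖)}`; the count is PART 1's table-free theorem, the same one that N0u ∕
N0v ∕ N0w's table-pencil ENDs derive inline.  With N0t's `muPart_locE_le_of_coresAt_pencil_families` (the 𝐃-step, twin of N0s §4)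
road P1's sentence «μ enters (B3) through the amplitude alone; the count is μ-free» is kernel at EVERY index of print's four
resummation steps (p. 17: 𝐃 at fixed Y₀; Y₀, P at fixed Z₀; Z₀ determining Z′₀; Z′₀ ⊂ Z).
Binder names VERBATIM N0u's ∕ N0v's ∕ N0w's ENDs with the source-pencil letters of N0s ∕ N0t (`v`, `μ₁`, `μ₀`, `sμ`, `A`), except:
N0v ∕ N0w's per-uncovered-cube weight `v : ℝ` ((2.35)'s `e^{−(κ₁−1)}` KIND) is spelled `vW` here because `v` is the source direction;
N0w's anchor bound `hA` is spelled `hA'` (`hA : 0 ≤ A` is the amplitude's sign, N0s's letter).  `hlink` (S40 supplies it), `hinner`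
(S41), `hanchor`∕`htransfer` (S44 on pv22's tori), `hadm` ((B1b) READING) and `hAmp` ((B3-form) READING) stay DISPLAYED.

PRINTED LOCI (TYPE∕CONTEXT only; [Balaban1988RGII] = CMP 116 (1988) pp. 17–20, renders `b2b-balaban-ref1/pages/1988-cmp116-rg-II-
cluster/…-p017…p020-x2.png`, quoted in PART 1 and in N0s ∕ N0u ∕ N0v ∕ N0w).  §2 of [Balaban1988RGII] carries NO observable and NO
source: the μ-parts are the owner's extension (GAPS-T4 C-t4r2-340 (n1): class NEW-UNPRINTED at small-field steps; (n2): termwise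
μ-differentiation needs its own radius — here the strict sub-window `μ₀ < μ₁`).

WHAT THIS DOES TO THE WALL (owner's reading; nothing re-labelled).  Inside «v1.8-proposed» (T4-DAG v45 Q47): the μ-part of the
dressed small-field output is kernel at the inner ∕ outer ∕ component indices with (B3-count) DISCHARGED by PART 1's table-free
statements and the source in `hAmp` ALONE; (B3-form), (B1b), the links ∕ transfer ∕ anchor ∕ `hinner` stay DISPLAYED; (B3-arith) is
N0t's.  NOTHING of (B3) is discharged on Bałaban's densities; 0 binders instantiated on Bałaban's (2.14) data; wall v1.7 (T4-DAG v47)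
does NOT move; NE1′ NOT printed, NOT proved; 0∕9; count 9 unchanged.

HONEST FRAMING.  Three one-step by-name compositions (N0s's μ-part count END ∘ PART 1) over SHAPES: the cores are the cell's typed
FORMAT of (2.14) with letters, not Bałaban's functions; `G`, `Gk` are `Geometry` HYPOTHESIS structures.  ABSOLUTE RULE honoured:
printed loci are TYPE∕CONTEXT only, never hypothesis-free facts; nothing internally minted is cited; [folklore] tags on kernel lemmas
only.  Rung (B)+1 on ONE finite T⁴ — NOT infinite volume, NOT a mass gap, NOT OS on ℝ⁴, NOT Clay.  HONEST DEPENDENCY: continuum YM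
on T⁴ ⇐ BetaPertH ∧ nine spine estimates (0/9 proved); BetaPertH ⇐ (D1) ∧ (D4) ∧ CAP+tail; G-an2-4 gates asym, D1 and NE2/3/4. -/
noncomputable section

namespace Summit.QuantumFields.BalabanUV.T4Continuum.NE1p.DressedSmallFieldLabelCountsMu

open Metric Set Complex MeasureTheory
open scoped BigOperators
open Literature.MathematicalPhysics.QuantumFieldTheory.Balaban1983to89 (LocDomainSys)
open Literature.MathematicalPhysics.QuantumFieldTheory.Balaban1983to89.B13FamilySum (coveringFamilies)
open Literature.MathematicalPhysics.QuantumFieldTheory.Balaban1983to89.T4OutputRate (Carriers)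
open Literature.MathematicalPhysics.QuantumFieldTheory.Balaban1983to89.B13Resummation (locE Geometry)
open Summit.QuantumFields.BalabanUV.T4Continuum.B13HistMeasurable (MeasPotFrame B13HistM)
open Summit.QuantumFields.BalabanUV.T4Continuum.B13TermParamGaussianBi (BiCore)
open Summit.QuantumFields.BalabanUV.T4Continuum.NE1p.DressedSmallFieldFamilyCount (muPart_locE_le_of_coresAt_pencil_count)
open Summit.QuantumFields.BalabanUV.T4Continuum.NE1p.DressedSmallFieldLabelCounts (count_innerLabels_geometry
  count_outerLabels_geometry count_components_geometry)

/-! ## ROAD P1's SOURCE-PENCIL TWINS: N0s's `muPart_locE_le_of_coresAt_pencil_count` ONCE per index, `hCount` := PART 1 §1 ∕ §2 ∕ §3 -/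

section MuTwins

variable {C : Carriers} {P : MeasPotFrame C} {Op : Type*} [NormedAddCommGroup Op] [NormedSpace ℂ Op]
variable (D : LocDomainSys) {Cube : Type} [DecidableEq Cube] (G : Geometry D Cube)

section Inner

variable {Dk : LocDomainSys} {CubeK : Type} [DecidableEq CubeK] {Bnd : Type} [DecidableEq Bnd] (Gk : Geometry Dk CubeK)
  {𝒴 : ℕ → (Σ _ : Finset CubeK, Finset Dk.Dom × Finset Bnd) → Type*} {dom : ∀ k i, 𝒴 k i → C.Dom}
  {β : ℕ → (Σ _ : Finset CubeK, Finset Dk.Dom × Finset Bnd) → Type*} [∀ k i, MeasurableSpace (β k i)]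
  {α : ℕ → (Σ _ : Finset CubeK, Finset Dk.Dom × Finset Bnd) → Type*} [∀ k i, NormedAddCommGroup (α k i)]
  [∀ k i, InnerProductSpace ℝ (α k i)] [∀ k i, FiniteDimensional ℝ (α k i)] [∀ k i, MeasurableSpace (α k i)]
  [∀ k i, BorelSpace (α k i)]

open Classical in
/-- **THE μ-PART (SOURCE PENCIL `h₀ + s • v`, `‖s‖ < μ₁`) FOR CORES INDEXED BY INNER LABELS, THE SECOND RESUMMATION STEP's COUNT
DISCHARGED** (kernel; N0s's `muPart_locE_le_of_coresAt_pencil_count` ONCE BY NAME at the index `Σ _ : Finset CubeK, Finset Dk.Dom ×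
Finset Bnd` with the table-blind majorant `(Π_{Y∈𝐃} α₆e^{−δκd_k Y}e^{−R(d_k Y+5)})·(s²t)^{#P}` and `hCount` := PART 1's
`count_innerLabels_geometry` (`0 ≤ Rkp` from `hrate`) — the source-pencil twin of N0u's END: the observable's table contribution `v`
scaled by the source enters ONLY `hAmp`, through the radius `‖h₀‖ + μ₁‖v‖`; count binders VERBATIM N0u's).  For `0 < μ₀ < μ₁`,
`‖sμ‖ ≤ μ₀`: `‖E[act sμ](X₀) − E[act 0](X₀)‖ ≤ (e ν c₁ K₀²·A·e^{−r₁ d(X₀)})·μ₀∕(μ₁ − μ₀)`. [folklore] -/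
theorem muPart_locE_le_of_coresAt_pencil_innerLabels {Win : Set (ℕ → ℝ)}
    {ctr : ℕ → (ℕ → ℝ) → C.BgB → Op × B13HistM P} {ROp RHist R' : ℕ → ℝ}
    (𝔊 : ∀ k i, C.Dom → BiCore P (dom k i) Op (β k i) (α k i))
    {mq bq N₀ : ℕ → (Σ _ : Finset CubeK, Finset Dk.Dom × Finset Bnd) → C.Dom → ℝ}
    (hroom : ∀ k, ROp k < R' k)
    (hm : ∀ k, ∀ g ∈ Win, ∀ (U : C.BgB) (X : C.Dom), C.scale X = k → ∀ i, 0 < mq k i X)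
    (hN : ∀ k, ∀ g ∈ Win, ∀ (U : C.BgB) (X : C.Dom), C.scale X = k → ∀ i,
      (∀ o ∈ ball (ctr k g U).1 (R' k), AEStronglyMeasurable ((𝔊 k i X).N o) (𝔊 k i X).lam) ∧
      (∀ p, DifferentiableOn ℂ (fun o => (𝔊 k i X).N o p) (ball (ctr k g U).1 (R' k))) ∧
      (∀ o ∈ ball (ctr k g U).1 (R' k), ∀ p, ‖(𝔊 k i X).N o p‖ ≤ N₀ k i X))
    (hq : ∀ k, ∀ g ∈ Win, ∀ (U : C.BgB) (X : C.Dom), C.scale X = k → ∀ i,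
      (∀ o ∈ ball (ctr k g U).1 (R' k),
        AEStronglyMeasurable (Function.uncurry ((𝔊 k i X).q o)) ((𝔊 k i X).lam.prod volume)) ∧
      (∀ p v, DifferentiableOn ℂ (fun o => (𝔊 k i X).q o p v) (ball (ctr k g U).1 (R' k))) ∧
      (∀ o ∈ ball (ctr k g U).1 (R' k), ∀ p v, mq k i X * ‖v‖ ^ 2 - bq k i X ≤ ((𝔊 k i X).q o p v).re))
    {k : ℕ} {g : ℕ → ℝ} (hg : g ∈ Win) {U : C.BgB} {o : Op} {h₀ v : B13HistM P} {μ₁ : ℝ}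
    (hO : ‖o - (ctr k g U).1‖ ≤ ROp k) (hH : ‖h₀ - (ctr k g U).2‖ + μ₁ * ‖v‖ ≤ RHist k)
    {emb : D.Dom → C.Dom} (hscale : ∀ Z, C.scale (emb Z) = k)
    {terms : D.Dom → Finset (Σ _ : Finset CubeK, Finset Dk.Dom × Finset Bnd)} {act : ℂ → D.Dom → ℂ}
    (hact : ∀ σ ∈ ball (0 : ℂ) μ₁, ∀ Z, act σ Z = ∑ i ∈ terms Z, (𝔊 k i (emb Z)).termAt o (h₀ + σ • v))
    {A Rkp r₁ b₅ μ₀ : ℝ} {X₀ : D.Dom} {sμ : ℂ} (hA : 0 ≤ A) (hr₁ : 0 ≤ r₁) (hb : r₁ * 5 ≤ b₅)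
    (hrate : r₁ + 2 * G.κ₀ + 2 ≤ Rkp) (hsmall : A * Real.exp (b₅ + 1) * G.K₀ * G.ν * G.c₁ ≤ 1)
    (foot : D.Dom → Dk.Dom) (hmono : ∀ Z, D.dj Z ≤ Dk.dj (foot Z)) (bondsOf : Finset CubeK → Finset Bnd)
    {δ κ α₆ R c₃₂ b₀ s t : ℝ} (hα₆ : 0 ≤ α₆) (hκ : Gk.κ₀ + 1 ≤ δ * κ) (h229 : Real.exp 1 * Gk.K₀ * Gk.c₁ * α₆ ≤ 1)
    (hs0 : 0 ≤ s) (hs1 : s ≤ 1) (ht : 0 ≤ t) (hb₀ : ∀ W, ((bondsOf W).card : ℝ) ≤ b₀ * W.card)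
    (hRR : Rkp ≤ R - Gk.c₁ * (Real.exp (R * c₃₂) * s * Real.exp (b₀ * t)))
    (hlink : ∀ Z, ∀ W ⊆ Gk.cubes (foot Z), ∀ Df ∈ coveringFamilies Finset.univ Gk.cubes (Gk.cubes (foot Z) \ W),
      Dk.dj (foot Z) + 5 ≤ ∑ Y ∈ Df, (Dk.dj Y + 5) + c₃₂ * W.card)
    (hadm : ∀ Z, ∀ l ∈ terms Z, l.1 ⊆ Gk.cubes (foot Z) ∧
      l.2.1 ∈ coveringFamilies Finset.univ Gk.cubes (Gk.cubes (foot Z) \ l.1) ∧ l.2.2 ⊆ bondsOf l.1 ∧ l.1.card ≤ 2 * l.2.2.card)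
    (hAmp : ∀ Z, G.cubes Z ⊆ G.cubes X₀ → ∀ l ∈ terms Z,
      (𝔊 k l (emb Z)).lam.real univ * ((𝔊 k l (emb Z)).wB * N₀ k l (emb Z) * Real.exp (bq k l (emb Z))) *
          (Real.pi / (mq k l (emb Z) / 2)) ^ (Module.finrank ℝ (α k l) / 2 : ℝ) *
        Real.exp ((𝔊 k l (emb Z)).N₁ * (‖h₀‖ + μ₁ * ‖v‖)) ≤
      A * ((∏ Y ∈ l.2.1, (α₆ * Real.exp (-(δ * κ * Dk.dj Y)) * Real.exp (-(R * (Dk.dj Y + 5))))) *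
        (s ^ 2 * t) ^ l.2.2.card))
    (h0 : 0 < μ₀) (h01 : μ₀ < μ₁) (hμ : ‖sμ‖ ≤ μ₀) :
    ‖locE G.ι G.cubes (act sμ) (G.cubes X₀) - locE G.ι G.cubes (act 0) (G.cubes X₀)‖ ≤
      Real.exp 1 * G.ν * G.c₁ * G.K₀ ^ 2 * A * Real.exp (-(r₁ * D.dj X₀)) * (μ₀ / (μ₁ - μ₀)) :=
  muPart_locE_le_of_coresAt_pencil_count D G 𝔊 hroom hm hN hq hg hO hH hscale hact hA hr₁ hb hrate hsmall
    (fun _ l => (∏ Y ∈ l.2.1, (α₆ * Real.exp (-(δ * κ * Dk.dj Y)) * Real.exp (-(R * (Dk.dj Y + 5))))) *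
      (s ^ 2 * t) ^ l.2.2.card) hAmp
    (fun Z _ => count_innerLabels_geometry Gk foot hmono bondsOf hα₆ hκ h229 hs0 hs1 ht hb₀ (by linarith [G.κ₀_nonneg]) hRR
      hlink hadm Z) h0 h01 hμ

end Inner

section Outer

variable {κ : D.Dom → Type}
  {𝒴 : ℕ → (Σ _ : Finset Cube, Σ F : Finset D.Dom, ∀ Z ∈ F, κ Z) → Type*} {dom : ∀ k i, 𝒴 k i → C.Dom}
  {β : ℕ → (Σ _ : Finset Cube, Σ F : Finset D.Dom, ∀ Z ∈ F, κ Z) → Type*} [∀ k i, MeasurableSpace (β k i)]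
  {α : ℕ → (Σ _ : Finset Cube, Σ F : Finset D.Dom, ∀ Z ∈ F, κ Z) → Type*} [∀ k i, NormedAddCommGroup (α k i)]
  [∀ k i, InnerProductSpace ℝ (α k i)] [∀ k i, FiniteDimensional ℝ (α k i)] [∀ k i, MeasurableSpace (α k i)]
  [∀ k i, BorelSpace (α k i)]

open Classical in
/-- **THE μ-PART (SOURCE PENCIL `h₀ + s • v`, `‖s‖ < μ₁`) FOR CORES INDEXED BY OUTER LABELS, RESUMMATION STEPS THREE AND FOUR's
COUNT DISCHARGED** (kernel; N0s's `muPart_locE_le_of_coresAt_pencil_count` ONCE BY NAME at the index `⟨W′, ⟨F, p⟩⟩` with the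
table-blind majorant `vW^{#W′}·Π_{Z′∈F} n Z′ (p Z′)` and `hCount` := PART 1's `count_outerLabels_geometry` (`0 ≤ Rkp` from `hrate`) — the
source-pencil twin of N0v's END; count binders VERBATIM N0v's except that N0v's per-uncovered-cube weight `v` is spelled `vW` (`v` is
the source direction); `hmember` and `hlink` DISPLAYED as there; the source enters ONLY `hAmp`). [folklore] -/
theorem muPart_locE_le_of_coresAt_pencil_outerLabels {Win : Set (ℕ → ℝ)}
    {ctr : ℕ → (ℕ → ℝ) → C.BgB → Op × B13HistM P} {ROp RHist R' : ℕ → ℝ}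
    (𝔊 : ∀ k i, C.Dom → BiCore P (dom k i) Op (β k i) (α k i))
    {mq bq N₀ : ℕ → (Σ _ : Finset Cube, Σ F : Finset D.Dom, ∀ Z ∈ F, κ Z) → C.Dom → ℝ}
    (hroom : ∀ k, ROp k < R' k)
    (hm : ∀ k, ∀ g ∈ Win, ∀ (U : C.BgB) (X : C.Dom), C.scale X = k → ∀ i, 0 < mq k i X)
    (hN : ∀ k, ∀ g ∈ Win, ∀ (U : C.BgB) (X : C.Dom), C.scale X = k → ∀ i,
      (∀ o ∈ ball (ctr k g U).1 (R' k), AEStronglyMeasurable ((𝔊 k i X).N o) (𝔊 k i X).lam) ∧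
      (∀ p, DifferentiableOn ℂ (fun o => (𝔊 k i X).N o p) (ball (ctr k g U).1 (R' k))) ∧
      (∀ o ∈ ball (ctr k g U).1 (R' k), ∀ p, ‖(𝔊 k i X).N o p‖ ≤ N₀ k i X))
    (hq : ∀ k, ∀ g ∈ Win, ∀ (U : C.BgB) (X : C.Dom), C.scale X = k → ∀ i,
      (∀ o ∈ ball (ctr k g U).1 (R' k),
        AEStronglyMeasurable (Function.uncurry ((𝔊 k i X).q o)) ((𝔊 k i X).lam.prod volume)) ∧
      (∀ p v, DifferentiableOn ℂ (fun o => (𝔊 k i X).q o p v) (ball (ctr k g U).1 (R' k))) ∧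
      (∀ o ∈ ball (ctr k g U).1 (R' k), ∀ p v, mq k i X * ‖v‖ ^ 2 - bq k i X ≤ ((𝔊 k i X).q o p v).re))
    {k : ℕ} {g : ℕ → ℝ} (hg : g ∈ Win) {U : C.BgB} {o : Op} {h₀ v : B13HistM P} {μ₁ : ℝ}
    (hO : ‖o - (ctr k g U).1‖ ≤ ROp k) (hH : ‖h₀ - (ctr k g U).2‖ + μ₁ * ‖v‖ ≤ RHist k)
    {emb : D.Dom → C.Dom} (hscale : ∀ Z, C.scale (emb Z) = k)
    {terms : D.Dom → Finset (Σ _ : Finset Cube, Σ F : Finset D.Dom, ∀ Z ∈ F, κ Z)} {act : ℂ → D.Dom → ℂ}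
    (hact : ∀ σ ∈ ball (0 : ℂ) μ₁, ∀ Z, act σ Z = ∑ i ∈ terms Z, (𝔊 k i (emb Z)).termAt o (h₀ + σ • v))
    {A Rkp r₁ b₅ μ₀ : ℝ} {X₀ : D.Dom} {sμ : ℂ} (hA : 0 ≤ A) (hr₁ : 0 ≤ r₁) (hb : r₁ * 5 ≤ b₅)
    (hrate : r₁ + 2 * G.κ₀ + 2 ≤ Rkp) (hsmall : A * Real.exp (b₅ + 1) * G.K₀ * G.ν * G.c₁ ≤ 1)
    (J : ∀ Z : D.Dom, Finset (κ Z)) (n : ∀ Z : D.Dom, κ Z → ℝ) (hn : ∀ Z j, 0 ≤ n Z j)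
    {a r R c' vW : ℝ} (ha : 0 ≤ a) (hvW : 0 ≤ vW)
    (hκ : G.κ₀ + 1 ≤ r) (h229 : Real.exp 1 * G.K₀ * G.c₁ * a ≤ 1)
    (hmember : ∀ Z', ∑ j ∈ J Z', n Z' j ≤ a * Real.exp (-(r * D.dj Z')) * Real.exp (-(R * (D.dj Z' + 5))))
    (hlink : ∀ Z, ∀ W ⊆ G.cubes Z, ∀ F ∈ coveringFamilies Finset.univ G.cubes (G.cubes Z \ W),
      D.dj Z - c' * W.card + 5 ≤ ∑ Z' ∈ F, (D.dj Z' + 5))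
    (hRR : Rkp ≤ R - G.c₁ * (vW * Real.exp (R * c')))
    (hadm : ∀ Z, ∀ l ∈ terms Z, l.1 ⊆ G.cubes Z ∧
      l.2.1 ∈ coveringFamilies Finset.univ G.cubes (G.cubes Z \ l.1) ∧ ∀ Z' (h : Z' ∈ l.2.1), l.2.2 Z' h ∈ J Z')
    (hAmp : ∀ Z, G.cubes Z ⊆ G.cubes X₀ → ∀ l ∈ terms Z,
      (𝔊 k l (emb Z)).lam.real univ * ((𝔊 k l (emb Z)).wB * N₀ k l (emb Z) * Real.exp (bq k l (emb Z))) *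
          (Real.pi / (mq k l (emb Z) / 2)) ^ (Module.finrank ℝ (α k l) / 2 : ℝ) *
        Real.exp ((𝔊 k l (emb Z)).N₁ * (‖h₀‖ + μ₁ * ‖v‖)) ≤
      A * (vW ^ l.1.card * ∏ x ∈ l.2.1.attach, n x.1 (l.2.2 x.1 x.2)))
    (h0 : 0 < μ₀) (h01 : μ₀ < μ₁) (hμ : ‖sμ‖ ≤ μ₀) :
    ‖locE G.ι G.cubes (act sμ) (G.cubes X₀) - locE G.ι G.cubes (act 0) (G.cubes X₀)‖ ≤
      Real.exp 1 * G.ν * G.c₁ * G.K₀ ^ 2 * A * Real.exp (-(r₁ * D.dj X₀)) * (μ₀ / (μ₁ - μ₀)) :=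
  muPart_locE_le_of_coresAt_pencil_count D G 𝔊 hroom hm hN hq hg hO hH hscale hact hA hr₁ hb hrate hsmall
    (fun _ l => vW ^ l.1.card * ∏ x ∈ l.2.1.attach, n x.1 (l.2.2 x.1 x.2)) hAmp
    (fun Z _ => count_outerLabels_geometry G J n hn ha hvW hκ h229 hmember hlink (by linarith [G.κ₀_nonneg]) hRR hadm Z)
    h0 h01 hμ

end Outer

section Comp

variable {Dk : LocDomainSys} {CubeK : Type} [DecidableEq CubeK] {ι₀ : Type} (Gk : Geometry Dk CubeK)
  {𝒴 : ℕ → (Σ _ : Finset Cube, Σ F : Finset D.Dom, ∀ Z ∈ F, (Σ _ : Dk.Dom, ι₀)) → Type*} {dom : ∀ k i, 𝒴 k i → C.Dom}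
  {β : ℕ → (Σ _ : Finset Cube, Σ F : Finset D.Dom, ∀ Z ∈ F, (Σ _ : Dk.Dom, ι₀)) → Type*} [∀ k i, MeasurableSpace (β k i)]
  {α : ℕ → (Σ _ : Finset Cube, Σ F : Finset D.Dom, ∀ Z ∈ F, (Σ _ : Dk.Dom, ι₀)) → Type*} [∀ k i, NormedAddCommGroup (α k i)]
  [∀ k i, InnerProductSpace ℝ (α k i)] [∀ k i, FiniteDimensional ℝ (α k i)] [∀ k i, MeasurableSpace (α k i)]
  [∀ k i, BorelSpace (α k i)]

open Classical in
/-- **THE μ-PART (SOURCE PENCIL `h₀ + s • v`, `‖s‖ < μ₁`) FOR CORES INDEXED BY OUTER LABELS WITH ANCHORED COMPONENTS AS INNER DATA,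
THE COUNT DISCHARGED** (kernel; N0s's `muPart_locE_le_of_coresAt_pencil_count` ONCE BY NAME with the table-blind majorant
`vW^{#W′}·Π_{Z′∈F} ε·m Z₀ l` and `hCount` := PART 1's `count_components_geometry` (`0 ≤ Rkp` from `hrate`) — the source-pencil twin of
N0w's END; count binders VERBATIM N0w's except `v ↦ vW`, `hA ↦ hA'`; `hinner`, `hanchor`∕`hA`, `htransfer`, `hlink` DISPLAYED as there; the
source enters ONLY `hAmp`). [folklore] -/
theorem muPart_locE_le_of_coresAt_pencil_components {Win : Set (ℕ → ℝ)}
    {ctr : ℕ → (ℕ → ℝ) → C.BgB → Op × B13HistM P} {ROp RHist R' : ℕ → ℝ}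
    (𝔊 : ∀ k i, C.Dom → BiCore P (dom k i) Op (β k i) (α k i))
    {mq bq N₀ : ℕ → (Σ _ : Finset Cube, Σ F : Finset D.Dom, ∀ Z ∈ F, (Σ _ : Dk.Dom, ι₀)) → C.Dom → ℝ}
    (hroom : ∀ k, ROp k < R' k)
    (hm : ∀ k, ∀ g ∈ Win, ∀ (U : C.BgB) (X : C.Dom), C.scale X = k → ∀ i, 0 < mq k i X)
    (hN : ∀ k, ∀ g ∈ Win, ∀ (U : C.BgB) (X : C.Dom), C.scale X = k → ∀ i,
      (∀ o ∈ ball (ctr k g U).1 (R' k), AEStronglyMeasurable ((𝔊 k i X).N o) (𝔊 k i X).lam) ∧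
      (∀ p, DifferentiableOn ℂ (fun o => (𝔊 k i X).N o p) (ball (ctr k g U).1 (R' k))) ∧
      (∀ o ∈ ball (ctr k g U).1 (R' k), ∀ p, ‖(𝔊 k i X).N o p‖ ≤ N₀ k i X))
    (hq : ∀ k, ∀ g ∈ Win, ∀ (U : C.BgB) (X : C.Dom), C.scale X = k → ∀ i,
      (∀ o ∈ ball (ctr k g U).1 (R' k),
        AEStronglyMeasurable (Function.uncurry ((𝔊 k i X).q o)) ((𝔊 k i X).lam.prod volume)) ∧
      (∀ p v, DifferentiableOn ℂ (fun o => (𝔊 k i X).q o p v) (ball (ctr k g U).1 (R' k))) ∧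
      (∀ o ∈ ball (ctr k g U).1 (R' k), ∀ p v, mq k i X * ‖v‖ ^ 2 - bq k i X ≤ ((𝔊 k i X).q o p v).re))
    {k : ℕ} {g : ℕ → ℝ} (hg : g ∈ Win) {U : C.BgB} {o : Op} {h₀ v : B13HistM P} {μ₁ : ℝ}
    (hO : ‖o - (ctr k g U).1‖ ≤ ROp k) (hH : ‖h₀ - (ctr k g U).2‖ + μ₁ * ‖v‖ ≤ RHist k)
    {emb : D.Dom → C.Dom} (hscale : ∀ Z, C.scale (emb Z) = k)
    {terms : D.Dom → Finset (Σ _ : Finset Cube, Σ F : Finset D.Dom, ∀ Z ∈ F, (Σ _ : Dk.Dom, ι₀))} {act : ℂ → D.Dom → ℂ}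
    (hact : ∀ σ ∈ ball (0 : ℂ) μ₁, ∀ Z, act σ Z = ∑ i ∈ terms Z, (𝔊 k i (emb Z)).termAt o (h₀ + σ • v))
    {A Rkp r₁ b₅ μ₀ : ℝ} {X₀ : D.Dom} {sμ : ℂ} (hA : 0 ≤ A) (hr₁ : 0 ≤ r₁) (hb : r₁ * 5 ≤ b₅)
    (hrate : r₁ + 2 * G.κ₀ + 2 ≤ Rkp) (hsmall : A * Real.exp (b₅ + 1) * G.K₀ * G.ν * G.c₁ ≤ 1)
    (I : Dk.Dom → Finset ι₀) (m : Dk.Dom → ι₀ → ℝ) (hm0 : ∀ Z₀ l, 0 ≤ m Z₀ l) (cl : Dk.Dom → D.Dom)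
    (anc : D.Dom → Finset CubeK) {ε c₀ R₀ Aₐ ℓ r R c' vW : ℝ} (hε : 0 ≤ ε) (hvW : 0 ≤ vW)
    (hinner : ∀ Z₀, ∑ l ∈ I Z₀, m Z₀ l ≤ Real.exp c₀ * Real.exp (-(R₀ * Dk.dj Z₀)))
    (hanchor : ∀ Z₀ Z', cl Z₀ = Z' → ∃ c ∈ anc Z', c ∈ Gk.cubes Z₀) (hA' : ∀ Z', ((anc Z').card : ℝ) ≤ Aₐ)
    (htransfer : ∀ Z₀ Z', cl Z₀ = Z' → ℓ * D.dj Z' ≤ Dk.dj Z₀) (hκR : Gk.κ₀ ≤ R₀) (hrate2 : r + R ≤ (R₀ - Gk.κ₀) * ℓ)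
    (hκ : G.κ₀ + 1 ≤ r) (h229 : Real.exp 1 * G.K₀ * G.c₁ * (ε * Real.exp c₀ * Aₐ * Gk.K₀ * Real.exp (5 * R)) ≤ 1)
    (hlink : ∀ Z, ∀ W ⊆ G.cubes Z, ∀ F ∈ coveringFamilies Finset.univ G.cubes (G.cubes Z \ W),
      D.dj Z - c' * W.card + 5 ≤ ∑ Z' ∈ F, (D.dj Z' + 5))
    (hRR : Rkp ≤ R - G.c₁ * (vW * Real.exp (R * c')))
    (hadm : ∀ Z, ∀ l ∈ terms Z, l.1 ⊆ G.cubes Z ∧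
      l.2.1 ∈ coveringFamilies Finset.univ G.cubes (G.cubes Z \ l.1) ∧
      ∀ Z' (h : Z' ∈ l.2.1), l.2.2 Z' h ∈ ((Finset.univ : Finset Dk.Dom).filter (fun Z₀ => cl Z₀ = Z')).sigma I)
    (hAmp : ∀ Z, G.cubes Z ⊆ G.cubes X₀ → ∀ l ∈ terms Z,
      (𝔊 k l (emb Z)).lam.real univ * ((𝔊 k l (emb Z)).wB * N₀ k l (emb Z) * Real.exp (bq k l (emb Z))) *
          (Real.pi / (mq k l (emb Z) / 2)) ^ (Module.finrank ℝ (α k l) / 2 : ℝ) *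
        Real.exp ((𝔊 k l (emb Z)).N₁ * (‖h₀‖ + μ₁ * ‖v‖)) ≤
      A * (vW ^ l.1.card * ∏ x ∈ l.2.1.attach, (ε * m (l.2.2 x.1 x.2).1 (l.2.2 x.1 x.2).2)))
    (h0 : 0 < μ₀) (h01 : μ₀ < μ₁) (hμ : ‖sμ‖ ≤ μ₀) :
    ‖locE G.ι G.cubes (act sμ) (G.cubes X₀) - locE G.ι G.cubes (act 0) (G.cubes X₀)‖ ≤
      Real.exp 1 * G.ν * G.c₁ * G.K₀ ^ 2 * A * Real.exp (-(r₁ * D.dj X₀)) * (μ₀ / (μ₁ - μ₀)) :=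
  muPart_locE_le_of_coresAt_pencil_count D G 𝔊 hroom hm hN hq hg hO hH hscale hact hA hr₁ hb hrate hsmall
    (fun _ l => vW ^ l.1.card * ∏ x ∈ l.2.1.attach, (ε * m (l.2.2 x.1 x.2).1 (l.2.2 x.1 x.2).2)) hAmp
    (fun Z _ => count_components_geometry G Gk I m hm0 cl anc hε hvW hinner hanchor hA' htransfer hκR hrate2 hκ h229 hlink
      (by linarith [G.κ₀_nonneg]) hRR hadm Z) h0 h01 hμ

end Comp

end MuTwins

end Summit.QuantumFields.BalabanUV.T4Continuum.NE1p.DressedSmallFieldLabelCountsMu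

end
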